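import Literature.NumberTheory.EllipticCurves.TunnellHalfIntegralForms
import HarnessLib

/-!
# Tunnell's `g`, `g θ_t` on the level of `q`-coefficients, computably: the printed expansions of
# p. 327 as theorems about the forms, Theorem 1's two expressions, and the `T(p²)` step of Theorem 2

Arithmetic complement to `Literature.NumberTheory.EllipticCurves.TunnellHalfIntegralForms`, which
constructs Tunnell's weight-`3/2` forms `g θ_t = tunnellForm t` on `ℍ` (Tunnell 1983, §1), proves
their `q`-expansions `qCoeffs (tunnellForm t) = (formCoeff t ·)` with
`formCoeff t N = d_t(N) = ∑_{(4m+1)² + 8n² + t k² = N} (-1)ⁿ`, proves Tunnell's sentence "It is easy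
to see by using Theorem 1 that for `n` odd, `a(n)` equals …" (p. 328: `d₂ = a`, `d₄ = b` on odd
arguments, `formCoeff_two_eq_a`), and reduces the last open input of **bsd.S29**
(`Literature.Tunnell1983_a/b_sq_eq_const_mul_L_one`) to Waldspurger's theorem as applied on p. 329.

There `formCoeff t N` is a sum over the box `[-N, N]³` inside a `noncomputable section`, so no
coefficient of the forms can be *evaluated* by the kernel. This file supplies the computable model
and what Tunnell's text does with explicit coefficients:

* `Literature.Tunnell1983.gCoeff n = c(n) = ∑_{(4m+1)² + 8k² = n} (-1)^k` — the coefficients of `g` in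
  **Theorem 1, second expression** `g = ∑_{(m,n) ∈ ℤ×ℤ} (-1)ⁿ q^{(4m+1)² + 8n²}` (the theta series
  of the character `η'` of `ℚ(√-2)`, p. 327; the series defining `tunnellG`), and
  `Literature.Tunnell1983.gCoeff' n = c'(n) = ∑_{(4m+1)² + 16k² = n} (-1)^{m+k}` — **the first expression**
  (the theta series `∑ η(𝔞) q^{N𝔞}` of the character `η` of the `(1+i)⁵`-ideal classes of `ℚ(i)`,
  p. 327), which the tree did not have; `Literature.Tunnell1983.gThetaCoeff t n = ∑_{j ∈ ℤ} c(n - t j²)`,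
  the coefficients of `g θ_t` (p. 328: "`a(n) = ∑ c(n - 2m²)` and `b(n) = ∑ c(n - 4m²)`"). All are
  sums over solution sets cut out of the box `[-⌊√n⌋, ⌊√n⌋]` built from `Finset.range`, hence
  kernel-computable (`decide +kernel`), and the membership lemmas (`mem_gRep`, `mem_thetaRep`) show
  the box loses nothing.
* **PROVED, the bridge** `formCoeff t N = gThetaCoeff t N` (`formCoeff_eq_gThetaCoeff`, `t ≥ 1`),
  hence `qCoeffs (tunnellForm t) = (gThetaCoeff t ·)` (`qCoeffs_tunnellForm_eq_gThetaCoeff`) and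
  `a(n) = ∑ c(n - 2m²)`, `b(n) = ∑ c(n - 4m²)` for odd `n` in computable form
  (`a_eq_gThetaCoeff`, `b_eq_gThetaCoeff`).
* **PROVED (by `decide` through the bridge), the expansions printed in the proof of Theorem 2,
  p. 327, as statements about the modular forms `g θ₂`, `g θ₈`, `g θ₃₂`**:
  "`g θ₂ = q + 2q³ + q⁹ - 2q¹¹ - 4q¹⁷ - 2q¹⁹ - 3q²⁵ + 4q³³ - 4q³⁵ + ⋯`,
  `g θ₈ = q + q⁹ - 4q¹⁷ - 3q²⁵ + 4q³³ + ⋯`, `g θ₃₂ = q - q⁹ - 2q¹⁷ + q²⁵ + 2q³³ + ⋯`"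
  (`qCoeffs_tunnellForm_two_expansion`, `…_eight_expansion`, `…_thirtyTwo_expansion`), together
  with `g θ₄` through `q⁴⁰` (not printed), the expansion `g = q - q⁹ - 2q¹⁷ + q²⁵ + 2q⁴¹ + q⁴⁹ + ⋯`
  of both expressions of Theorem 1 (`gCoeff_expansion`, `gCoeff'_expansion`), and the identity of
  the proof of Theorem 2, "it is clear that `2 g θ₃₂ - g θ₈ = ∑ χ(m) m q^{m²}`, where `χ` is the
  nontrivial quadratic character of conductor `4`", through `q⁴⁹`
  (`qCoeffs_two_mul_thirtyTwo_sub_eight_expansion`). These are the coefficients Tunnell's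
  "Consideration of `T(3²)` and `T(5²)`" (p. 327) operates on.
* **PROVED, supports** not in the sibling file: `c(n) = 0` unless `n ≡ 1 (8)` (p. 327, "since
  `g = ∑ c(n) qⁿ` and `c(n) = 0` unless `n ≡ 1 (8)`"; `gCoeff_eq_zero_of_emod_eight_ne_one`),
  `c(n) = 0` for `n ≤ 0` (p. 328), the same for `c'`, and the supports of `g θ₃₂` (the third basis
  vector of `S_{3/2}(128, 1)`, p. 327) and `g θ₁` (of `S_{3/2}(128, χ₂)`):
  `formCoeff_thirtyTwo_eq_zero` (`n ≢ 1`), `formCoeff_one_eq_zero` (`n ≢ 1, 2, 5 (8)`).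
* **Theorem 1's equality of its two expressions, as a named fact**
  (`Literature.Tunnell1983_gCoeff'_eq_gCoeff : ∀ n, c'(n) = c(n)`) with `decide` evidence through `n = 80`
  (`gCoeff'_eq_gCoeff_of_lt`). In print this is the identification of the unique newform of
  weight `1`, level `128` and character `χ₋₂` with the theta series of Hecke characters of both
  `ℚ(i)` and `ℚ(√-2)` (Labesse–Langlands or Deligne–Serre, pp. 326–327); by Jacobi's triple
  product both also equal `q ∏ (1 - q^{8n})(1 - q^{16n})` (Remark, p. 327). Neither route is in
  Mathlib. The modular side (`tunnellG`) uses only the second expression.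
* **PROVED, the step "exponents modulo `8`" of the proof of Theorem 2 on Shimura's operator**
  (pp. 327–328: "It is clear from the formula for the action of `T(p²)` [18, Theorem 1.7] that
  `T(p²)(g(θ₂ - θ₈))` and `T(p²)(g θ₈)` have the same properties with respect to exponents modulo
  `8` appearing in the `q`-expansion"): for odd `p`, `heckeTSq k χ p` maps sequences supported on a
  class (or two classes) modulo `8` to sequences supported there, as `p² ≡ 1 (mod 8)`
  (`Literature.NumberTheory.EllipticCurves.ModularForms.heckeTSq_apply_eq_zero_of_mod_eight`, `…_mod_eight₂`); in particular for the
  `q`-expansions of `g θ₈` (class `1`) and `g(θ₂ - θ₈)` (class `3`)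
  (`heckeTSq_qCoeffs_tunnellForm_eight_eq_zero`, `heckeTSq_qCoeffs_tunnellForm_two_sub_eight_eq_zero`).

## Design

* `gCoeff`, `gCoeff'`, `gThetaCoeff` are `ℤ`-valued and indexed by `n : ℤ` (so that `n - t j²`
  needs no side condition). The box is the image of `Finset.range (2B + 1)` under `i ↦ i - B`
  rather than `Finset.Icc (-B) B`, whose order instances on `ℤ` are noncomputable in this Mathlib.
* Nothing here re-proves the sibling's ternary identity: `a_eq_gThetaCoeff` is
  `formCoeff_two_eq_a` composed with the bridge.

## References

* J. B. Tunnell, *A classical Diophantine problem and modular forms of weight 3/2*, Invent. Math.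
  72 (1983) 323–334: Theorem 1 and the Remark (pp. 326–327), proof of Theorem 2 (pp. 327–328),
  "For future reference …" (p. 328), p. 329. Read on the GDZ scan of Inventiones 72
  (`PPN356556735_0072`, `LOG_0021`).
* G. Shimura, *On modular forms of half integral weight*, Ann. of Math. 97 (1973) 440–481,
  Thm. 1.7 (the formula for `T(p²)`, vendored as `Literature.NumberTheory.EllipticCurves.ModularForms.heckeTSq`).
-/

namespace Literature.NumberTheory.EllipticCurves.Tunnell1983

open Finset ModularForms

/-! ### Boxes and solution sets -/

/-- The integer box `{-B, …, B}` as a `Finset ℤ`, realised as the image of `Finset.range (2B + 1)`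
under `i ↦ i - B` (kernel-computable). [folklore] -/
def box (B : ℕ) : Finset ℤ :=
  (Finset.range (2 * B + 1)).map
    ⟨fun i : ℕ ↦ (i : ℤ) - B, fun i j h ↦ by
      have h' : (i : ℤ) = j := sub_left_injective h
      exact_mod_cast h'⟩

/-- `m ∈ box B ↔ -B ≤ m ≤ B`. [folklore] -/
theorem mem_box {B : ℕ} {m : ℤ} : m ∈ box B ↔ -(B : ℤ) ≤ m ∧ m ≤ B := by
  simp only [box, Finset.mem_map, Finset.mem_range, Function.Embedding.coeFn_mk]
  constructor
  · rintro ⟨i, hi, rfl⟩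
    omega
  · rintro ⟨h₁, h₂⟩
    exact ⟨(m + B).toNat, by omega, by omega⟩

/-- `m ∈ box B ↔ |m| ≤ B`. [folklore] -/
theorem mem_box_iff_natAbs_le {B : ℕ} {m : ℤ} : m ∈ box B ↔ m.natAbs ≤ B := by
  rw [mem_box]
  omega

/-- The box radius `⌊√n⌋` (`0` for `n ≤ 0`) used for all solution sets of level `n`. [folklore] -/
def sqrtBound (n : ℤ) : ℕ := Nat.sqrt n.toNat

/-- If `m² ≤ n` then `|m| ≤ ⌊√n⌋`. [folklore] -/
theorem natAbs_le_sqrtBound {m n : ℤ} (h : m ^ 2 ≤ n) : m.natAbs ≤ sqrtBound n := by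
  unfold sqrtBound
  rw [Nat.le_sqrt]
  have h1 : ((m.natAbs * m.natAbs : ℕ) : ℤ) = m ^ 2 := by
    rw [Nat.cast_mul, Int.natAbs_mul_self', sq]
  generalize m.natAbs * m.natAbs = a at *
  omega

/-- `|m| ≤ |4m + 1|` for every integer `m`. [folklore] -/
theorem natAbs_le_natAbs_four_mul_add_one (m : ℤ) : m.natAbs ≤ (4 * m + 1).natAbs := by
  omega

/-- The representations counted (with sign) by `c(n)`:
`gRep n = {(m, k) ∈ ℤ² | (4m + 1)² + 8k² = n}` (Tunnell 1983, Thm 1, second expression).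
[cite: Tunnell1983Congruent, Thm 1] -/
def gRep (n : ℤ) : Finset (ℤ × ℤ) :=
  (box (sqrtBound n) ×ˢ box (sqrtBound n)).filter fun p ↦ (4 * p.1 + 1) ^ 2 + 8 * p.2 ^ 2 = n

/-- `(m, k) ∈ gRep n ↔ (4m + 1)² + 8k² = n` (the box loses nothing). [folklore] -/
theorem mem_gRep {n : ℤ} {p : ℤ × ℤ} : p ∈ gRep n ↔ (4 * p.1 + 1) ^ 2 + 8 * p.2 ^ 2 = n := by
  simp only [gRep, Finset.mem_filter, Finset.mem_product, mem_box_iff_natAbs_le]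
  constructor
  · exact fun h ↦ h.2
  · intro h
    refine ⟨⟨?_, ?_⟩, h⟩
    · refine (natAbs_le_natAbs_four_mul_add_one p.1).trans (natAbs_le_sqrtBound ?_)
      nlinarith [sq_nonneg p.2]
    · exact natAbs_le_sqrtBound (by nlinarith [sq_nonneg p.2, sq_nonneg (4 * p.1 + 1)])

/-- The representations counted (with sign) by `c'(n)`:
`gRep' n = {(m, k) ∈ ℤ² | (4m + 1)² + 16k² = n}` (Tunnell 1983, Thm 1, first expression).
[cite: Tunnell1983Congruent, Thm 1] -/
def gRep' (n : ℤ) : Finset (ℤ × ℤ) :=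
  (box (sqrtBound n) ×ˢ box (sqrtBound n)).filter fun p ↦ (4 * p.1 + 1) ^ 2 + 16 * p.2 ^ 2 = n

/-- `(m, k) ∈ gRep' n ↔ (4m + 1)² + 16k² = n`. [folklore] -/
theorem mem_gRep' {n : ℤ} {p : ℤ × ℤ} : p ∈ gRep' n ↔ (4 * p.1 + 1) ^ 2 + 16 * p.2 ^ 2 = n := by
  simp only [gRep', Finset.mem_filter, Finset.mem_product, mem_box_iff_natAbs_le]
  constructor
  · exact fun h ↦ h.2
  · intro h
    refine ⟨⟨?_, ?_⟩, h⟩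
    · refine (natAbs_le_natAbs_four_mul_add_one p.1).trans (natAbs_le_sqrtBound ?_)
      nlinarith [sq_nonneg p.2]
    · exact natAbs_le_sqrtBound (by nlinarith [sq_nonneg p.2, sq_nonneg (4 * p.1 + 1)])

/-- The solutions of `t j² + (4m + 1)² + c k² = n` in `ℤ³`, as a `Finset` (coordinates
`(j, m, k)`); for `c = 8` these index the terms of `∑_j c(n - t j²)` (Tunnell 1983, p. 328), i.e.
the sibling's `fiber t n` with the coordinates `((m, k), j)` permuted.
[cite: Tunnell1983Congruent, p. 328] -/
def thetaRep (t c n : ℤ) : Finset (ℤ × ℤ × ℤ) :=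
  (box (sqrtBound n) ×ˢ (box (sqrtBound n) ×ˢ box (sqrtBound n))).filter
    fun q ↦ t * q.1 ^ 2 + (4 * q.2.1 + 1) ^ 2 + c * q.2.2 ^ 2 = n

/-- `(j, m, k) ∈ thetaRep t c n ↔ t j² + (4m + 1)² + c k² = n`, for `t, c ≥ 1`. [folklore] -/
theorem mem_thetaRep {t c : ℤ} (ht : 0 < t) (hc : 0 < c) {n : ℤ} {q : ℤ × ℤ × ℤ} :
    q ∈ thetaRep t c n ↔ t * q.1 ^ 2 + (4 * q.2.1 + 1) ^ 2 + c * q.2.2 ^ 2 = n := by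
  simp only [thetaRep, Finset.mem_filter, Finset.mem_product, mem_box_iff_natAbs_le]
  constructor
  · exact fun h ↦ h.2
  · intro h
    have h0 := sq_nonneg q.1
    have h1 := sq_nonneg (4 * q.2.1 + 1)
    have h2 := sq_nonneg q.2.2
    have ht2 : q.1 ^ 2 ≤ t * q.1 ^ 2 := by nlinarith
    have hc2 : q.2.2 ^ 2 ≤ c * q.2.2 ^ 2 := by nlinarith
    refine ⟨⟨natAbs_le_sqrtBound (by linarith), ?_, natAbs_le_sqrtBound (by linarith)⟩, h⟩
    exact (natAbs_le_natAbs_four_mul_add_one q.2.1).trans (natAbs_le_sqrtBound (by linarith))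

/-! ### The coefficients `c(n)`, `c'(n)` of Theorem 1 and the coefficients of `g θ_t` -/

/-- **`c(n)`, the `n`-th coefficient of the weight-one form `g` of Tunnell's Theorem 1 in its
second expression** `g = ∑_{(m,k) ∈ ℤ×ℤ} (-1)^k q^{(4m+1)² + 8k²}` (the theta series of the
character `η'` of `ℚ(√-2)`, p. 327; the series defining `tunnellG`):
`c(n) = ∑_{(4m+1)² + 8k² = n} (-1)^k`. [cite: Tunnell1983Congruent, Thm 1 and p. 328] -/
def gCoeff (n : ℤ) : ℤ :=
  ∑ p ∈ gRep n, (-1) ^ p.2.natAbs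

/-- **`c'(n)`, the `n`-th coefficient of the first expression of Theorem 1**,
`g = ∑_{(m,n) ∈ ℤ×ℤ} (-1)^{m+n} q^{(4m+1)² + 16n²}` (the theta series `∑ η(𝔞) q^{N𝔞}` of the
character `η` of the `(1 + i)⁵`-ideal classes of `ℚ(i)` "which is trivial on `(1 + 2i)` and `-1`
on `(5)`", p. 327): `c'(n) = ∑_{(4m+1)² + 16k² = n} (-1)^{m+k}`. [cite: Tunnell1983Congruent, Thm 1] -/
def gCoeff' (n : ℤ) : ℤ :=
  ∑ p ∈ gRep' n, (-1) ^ (p.1.natAbs + p.2.natAbs)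

/-- **The `n`-th coefficient of `g θ_t`**, `θ_t = ∑_{m ∈ ℤ} q^{t m²}`: the Cauchy product
`∑_{j ∈ ℤ} c(n - t j²)` (Tunnell 1983, p. 328: "`a(n) = ∑_{m ∈ ℤ} c(n - 2m²)` and
`b(n) = ∑_{m ∈ ℤ} c(n - 4m²)`"; likewise for `g θ₈`, `g θ₃₂`, `g θ₁₆`, `g θ₁` of Theorems 1–2).
Intended for `t ≥ 1` (for `t = 0` the sum over `j` would be infinite; the value here is junk).
[cite: Tunnell1983Congruent, p. 328] -/
def gThetaCoeff (t : ℕ) (n : ℤ) : ℤ :=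
  ∑ j ∈ box (sqrtBound n), gCoeff (n - t * j ^ 2)

/-- Unfolding lemma for `gCoeff`. [folklore] -/
theorem gCoeff_def (n : ℤ) : gCoeff n = ∑ p ∈ gRep n, (-1) ^ p.2.natAbs := rfl

/-- Unfolding lemma for `gCoeff'`. [folklore] -/
theorem gCoeff'_def (n : ℤ) : gCoeff' n = ∑ p ∈ gRep' n, (-1) ^ (p.1.natAbs + p.2.natAbs) := rfl

/-- Unfolding lemma for `gThetaCoeff`. [folklore] -/
theorem gThetaCoeff_def (t : ℕ) (n : ℤ) :
    gThetaCoeff t n = ∑ j ∈ box (sqrtBound n), gCoeff (n - t * j ^ 2) := rfl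

/-- `∑_{j} c(n - t j²) = ∑_{t j² + (4m+1)² + 8k² = n} (-1)^k`: unfold `c` and collect the double
sum over the solution set `thetaRep t 8 n`. [folklore] -/
theorem gThetaCoeff_eq_sum_thetaRep {t : ℕ} (ht : 0 < t) (n : ℤ) :
    gThetaCoeff t n = ∑ q ∈ thetaRep t 8 n, (-1) ^ q.2.2.natAbs := by
  have ht' : (0 : ℤ) < t := by exact_mod_cast ht
  have h : ∀ q : ℤ × ℤ × ℤ,
      q ∈ thetaRep t 8 n ↔ q.1 ∈ box (sqrtBound n) ∧ q.2 ∈ gRep (n - t * q.1 ^ 2) := by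
    intro q
    rw [mem_thetaRep ht' (by norm_num), mem_gRep, mem_box_iff_natAbs_le]
    constructor
    · intro hq
      have h1 := sq_nonneg (4 * q.2.1 + 1)
      have h2 := sq_nonneg q.2.2
      have h3 : q.1 ^ 2 ≤ (t : ℤ) * q.1 ^ 2 := by nlinarith [sq_nonneg q.1]
      exact ⟨natAbs_le_sqrtBound (by linarith), by linarith⟩
    · rintro ⟨-, hq⟩
      linarith
  rw [gThetaCoeff_def, Finset.sum_finset_product (thetaRep t 8 n) (box (sqrtBound n))
    (fun j ↦ gRep (n - t * j ^ 2)) h]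
  rfl

/-! ### The bridge to `formCoeff` and to the forms `g θ_t` -/

/-- **`d_t(N) = ∑_j c(N - t j²)`**: the sibling's `formCoeff t N` (the `N`-th `q`-expansion
coefficient of `g θ_t = tunnellForm t`, `qCoeffs_tunnellForm`) equals the computable
`gThetaCoeff t N`, for `t ≥ 1` — both are `∑ (-1)ⁿ` over the solutions of
`(4m+1)² + 8n² + t k² = N`. [cite: Tunnell1983Congruent, p. 328] -/
theorem formCoeff_eq_gThetaCoeff {t : ℕ} (ht : 0 < t) (N : ℕ) :
    formCoeff t N = gThetaCoeff t N := by
  have ht' : (0 : ℤ) < t := by exact_mod_cast ht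
  rw [formCoeff_eq_sum_fiber, gThetaCoeff_eq_sum_thetaRep ht]
  refine Finset.sum_nbij' (fun v ↦ (v.2, v.1.1, v.1.2)) (fun q ↦ ((q.2.1, q.2.2), q.1))
    ?_ ?_ ?_ ?_ ?_
  · rintro ⟨⟨m, k⟩, j⟩ hv
    rw [mem_fiber ht, expo] at hv
    rw [mem_thetaRep ht' (by norm_num)]
    dsimp only at hv ⊢
    linear_combination hv
  · rintro ⟨j, m, k⟩ hq
    rw [mem_thetaRep ht' (by norm_num)] at hq
    rw [mem_fiber ht, expo]
    dsimp only at hq ⊢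
    linear_combination hq
  · rintro ⟨⟨m, k⟩, j⟩ -
    rfl
  · rintro ⟨j, m, k⟩ -
    rfl
  · rintro ⟨⟨m, k⟩, j⟩ -
    rfl

/-- **The `q`-expansion coefficients of `g θ_t` are the computable `∑_j c(N - t j²)`**
(`qCoeffs_tunnellForm` through the bridge). [cite: Tunnell1983Congruent, p. 328] -/
theorem qCoeffs_tunnellForm_eq_gThetaCoeff {t : ℕ} (ht : 0 < t) :
    qCoeffs (tunnellForm t) = fun N : ℕ ↦ ((gThetaCoeff t N : ℤ) : ℂ) := by
  rw [qCoeffs_tunnellForm ht]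
  funext N
  rw [formCoeff_eq_gThetaCoeff ht]

/-- **`a(n) = ∑_{m ∈ ℤ} c(n - 2m²)` for odd `n`** (Tunnell 1983, p. 328) in computable form: the
tree's ternary-form `a` (`Literature.NumberTheory.EllipticCurves.Tunnell1983.a`) through `formCoeff_two_eq_a` and the bridge.
[cite: Tunnell1983Congruent, p. 328] -/
theorem a_eq_gThetaCoeff {n : ℕ} (hn : Odd n) : a n = gThetaCoeff 2 n := by
  rw [← formCoeff_two_eq_a hn, formCoeff_eq_gThetaCoeff two_pos]

/-- **`b(n) = ∑_{m ∈ ℤ} c(n - 4m²)` for odd `n`** (Tunnell 1983, p. 328) in computable form.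
[cite: Tunnell1983Congruent, p. 328] -/
theorem b_eq_gThetaCoeff {n : ℕ} (hn : Odd n) : b n = gThetaCoeff 4 n := by
  rw [← formCoeff_four_eq_b hn, formCoeff_eq_gThetaCoeff (by norm_num)]

/-! ### Supports modulo `8` -/

/-- `(4m + 1)² + 8k² = 8(2m² + m + k²) + 1 ≡ 1 (mod 8)`. [folklore] -/
theorem sq_four_mul_add_one_add_emod_eight (m k : ℤ) :
    ((4 * m + 1) ^ 2 + 8 * k ^ 2) % 8 = 1 := by
  have : (4 * m + 1) ^ 2 + 8 * k ^ 2 = 8 * (2 * m ^ 2 + m + k ^ 2) + 1 := by ring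
  omega

/-- `j² ≡ 0, 1` or `4 (mod 8)`. [folklore] -/
theorem sq_emod_eight (j : ℤ) : j ^ 2 % 8 = 0 ∨ j ^ 2 % 8 = 1 ∨ j ^ 2 % 8 = 4 := by
  have h : j % 8 = 0 ∨ j % 8 = 1 ∨ j % 8 = 2 ∨ j % 8 = 3 ∨ j % 8 = 4 ∨ j % 8 = 5 ∨ j % 8 = 6 ∨
      j % 8 = 7 := by omega
  rw [sq, Int.mul_emod]
  rcases h with h | h | h | h | h | h | h | h <;> simp [h]

/-- **"`c(n) = 0` unless `n ≡ 1 (8)`"** (Tunnell 1983, p. 327): `(4m+1)² + 8k² ≡ 1 (mod 8)`.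
[cite: Tunnell1983Congruent, p. 327] -/
theorem gCoeff_eq_zero_of_emod_eight_ne_one {n : ℤ} (h : n % 8 ≠ 1) : gCoeff n = 0 := by
  rw [gCoeff_def]
  refine Finset.sum_eq_zero fun p hp ↦ ?_
  rw [mem_gRep] at hp
  exact absurd (hp ▸ sq_four_mul_add_one_add_emod_eight p.1 p.2) h

/-- "`c(n) = 0` for `n < 0`" (Tunnell 1983, p. 328) — indeed for `n ≤ 0`, as `(4m+1)² ≥ 1`.
[cite: Tunnell1983Congruent, p. 328] -/
theorem gCoeff_eq_zero_of_lt_one {n : ℤ} (h : n < 1) : gCoeff n = 0 := by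
  rw [gCoeff_def]
  refine Finset.sum_eq_zero fun p hp ↦ ?_
  rw [mem_gRep] at hp
  nlinarith [one_le_sq_four_mul_add_one p.1, sq_nonneg p.2]

/-- `c'(n) = 0` unless `n ≡ 1 (8)`: `(4m+1)² + 16k² ≡ 1 (mod 8)`. [folklore] -/
theorem gCoeff'_eq_zero_of_emod_eight_ne_one {n : ℤ} (h : n % 8 ≠ 1) : gCoeff' n = 0 := by
  rw [gCoeff'_def]
  refine Finset.sum_eq_zero fun p hp ↦ ?_
  rw [mem_gRep'] at hp
  have : (4 * p.1 + 1) ^ 2 + 16 * p.2 ^ 2 = 8 * (2 * p.1 ^ 2 + p.1 + 2 * p.2 ^ 2) + 1 := by ring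
  omega

/-- `c'(n) = 0` for `n ≤ 0`. [folklore] -/
theorem gCoeff'_eq_zero_of_lt_one {n : ℤ} (h : n < 1) : gCoeff' n = 0 := by
  rw [gCoeff'_def]
  refine Finset.sum_eq_zero fun p hp ↦ ?_
  rw [mem_gRep'] at hp
  nlinarith [one_le_sq_four_mul_add_one p.1, sq_nonneg p.2]

/-- If no `j ∈ ℤ` has `n - t j² ≡ 1 (mod 8)`, the `n`-th coefficient of `g θ_t` vanishes.
[folklore] -/
theorem gThetaCoeff_eq_zero_of_forall {t : ℕ} {n : ℤ} (h : ∀ j : ℤ, (n - t * j ^ 2) % 8 ≠ 1) :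
    gThetaCoeff t n = 0 :=
  Finset.sum_eq_zero fun j _ ↦ gCoeff_eq_zero_of_emod_eight_ne_one (h j)

/-- The coefficients of `g θ_t` vanish in degrees `n ≤ 0` (`g` has no constant term).
[folklore] -/
theorem gThetaCoeff_eq_zero_of_lt_one {t : ℕ} {n : ℤ} (h : n < 1) : gThetaCoeff t n = 0 :=
  Finset.sum_eq_zero fun j _ ↦ gCoeff_eq_zero_of_lt_one (by
    have : (0 : ℤ) ≤ t * j ^ 2 := by positivity
    linarith)

/-- For `8 ∣ t` (`g θ₈`, `g θ₁₆`, `g θ₃₂`) the coefficients of `g θ_t` live on `n ≡ 1 (mod 8)`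
(Tunnell 1983, p. 327: "`g θ₈` has exponents in the `q`-expansion all congruent to `1` modulo
`8`"). [cite: Tunnell1983Congruent, p. 327] -/
theorem gThetaCoeff_eq_zero_of_eight_dvd {t : ℕ} (ht : 8 ∣ t) {n : ℤ} (h1 : n % 8 ≠ 1) :
    gThetaCoeff t n = 0 := by
  obtain ⟨s, rfl⟩ := ht
  refine gThetaCoeff_eq_zero_of_forall fun j ↦ ?_
  push_cast
  have : (n - 8 * (s : ℤ) * j ^ 2) % 8 = n % 8 := by
    rw [show n - 8 * (s : ℤ) * j ^ 2 = n + 8 * (-(s : ℤ) * j ^ 2) by ring,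
      Int.add_mul_emod_self_left]
  rw [this]
  exact h1

/-- **`g θ₃₂`, the third basis vector of the weight-`3/2` cusp forms of level `128` and trivial
character (p. 327), lives on `n ≡ 1 (mod 8)`**, on `formCoeff`. [cite: Tunnell1983Congruent, p. 327] -/
theorem formCoeff_thirtyTwo_eq_zero {N : ℕ} (hN : N % 8 ≠ 1) : formCoeff 32 N = 0 := by
  rw [formCoeff_eq_gThetaCoeff (by norm_num)]
  exact gThetaCoeff_eq_zero_of_eight_dvd ⟨4, rfl⟩ (by omega)

/-- The coefficients of `g θ₁` (Theorem 1: `{g θ₁, g θ₄, g θ₁₆}` is a basis of the weight-`3/2`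
cusp forms of level `128` and character `χ₂`) live on the classes `1, 2, 5 (mod 8)`
(`j² ≡ 0, 1, 4`). [cite: Tunnell1983Congruent, p. 327] -/
theorem formCoeff_one_eq_zero {N : ℕ} (h1 : N % 8 ≠ 1) (h2 : N % 8 ≠ 2) (h5 : N % 8 ≠ 5) :
    formCoeff 1 N = 0 := by
  rw [formCoeff_eq_gThetaCoeff one_pos]
  refine gThetaCoeff_eq_zero_of_forall fun j ↦ ?_
  push_cast
  rcases sq_emod_eight j with h | h | h <;> omega

/-! ### The printed expansions (Tunnell 1983, p. 327) and further values, by `decide` -/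

/-- **The expansion of `g` through `q⁴⁹`**: `c(0), …, c(49)`, i.e.
`g = q - q⁹ - 2q¹⁷ + q²⁵ + 2q⁴¹ + q⁴⁹ + ⋯` (Theorem 1; the Remark's `q ∏ (1 - q^{8n})(1 - q^{16n})`
begins the same way). [cite: Tunnell1983Congruent, Thm 1] -/
theorem gCoeff_expansion :
    (List.range 50).map (fun n : ℕ ↦ gCoeff n) =
      [0, 1, 0, 0, 0, 0, 0, 0, 0, -1, 0, 0, 0, 0, 0, 0, 0, -2, 0, 0, 0, 0, 0, 0, 0, 1,
        0, 0, 0, 0, 0, 0, 0, 0, 0, 0, 0, 0, 0, 0, 0, 2, 0, 0, 0, 0, 0, 0, 0, 1] := by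
  decide +kernel

/-- The first expression of Theorem 1 has the same expansion through `q⁴⁹`: `c'(0), …, c'(49)`.
[cite: Tunnell1983Congruent, Thm 1] -/
theorem gCoeff'_expansion :
    (List.range 50).map (fun n : ℕ ↦ gCoeff' n) =
      [0, 1, 0, 0, 0, 0, 0, 0, 0, -1, 0, 0, 0, 0, 0, 0, 0, -2, 0, 0, 0, 0, 0, 0, 0, 1,
        0, 0, 0, 0, 0, 0, 0, 0, 0, 0, 0, 0, 0, 0, 0, 2, 0, 0, 0, 0, 0, 0, 0, 1] := by
  decide +kernel

/-- `g θ₂` through `q³⁵` on the computable side: the values of `∑_j c(n - 2j²)`, `n < 36`.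
[cite: Tunnell1983Congruent, proof of Thm 2, p. 327] -/
theorem gThetaCoeff_two_expansion :
    (List.range 36).map (fun n : ℕ ↦ gThetaCoeff 2 n) =
      [0, 1, 0, 2, 0, 0, 0, 0, 0, 1, 0, -2, 0, 0, 0, 0, 0, -4, 0, -2, 0, 0, 0, 0, 0, -3,
        0, 0, 0, 0, 0, 0, 0, 4, 0, -4] := by
  decide +kernel

/-- `g θ₈` through `q³³` on the computable side. [cite: Tunnell1983Congruent, proof of Thm 2, p. 327] -/
theorem gThetaCoeff_eight_expansion :
    (List.range 34).map (fun n : ℕ ↦ gThetaCoeff 8 n) =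
      [0, 1, 0, 0, 0, 0, 0, 0, 0, 1, 0, 0, 0, 0, 0, 0, 0, -4, 0, 0, 0, 0, 0, 0, 0, -3,
        0, 0, 0, 0, 0, 0, 0, 4] := by
  decide +kernel

/-- `g θ₃₂` through `q³³` on the computable side. [cite: Tunnell1983Congruent, proof of Thm 2, p. 327] -/
theorem gThetaCoeff_thirtyTwo_expansion :
    (List.range 34).map (fun n : ℕ ↦ gThetaCoeff 32 n) =
      [0, 1, 0, 0, 0, 0, 0, 0, 0, -1, 0, 0, 0, 0, 0, 0, 0, -2, 0, 0, 0, 0, 0, 0, 0, 1,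
        0, 0, 0, 0, 0, 0, 0, 2] := by
  decide +kernel

/-- `g θ₄ = ∑ b(n) qⁿ` through `q⁴⁰` on the computable side (not printed by Tunnell, who treats the
character-`χ₂` case as "analogous"):
`g θ₄ = q + 2q⁵ - q⁹ - 2q¹³ - 4q²¹ - q²⁵ + 2q²⁹ - 4q³³ + 2q³⁷ + ⋯`; in particular `b(1) = 1`,
`b(5) = 2` (the values used with `L(E², 1)`, `L(E¹⁰, 1)` on p. 329). [cite: Tunnell1983Congruent, p. 328] -/
theorem gThetaCoeff_four_expansion :
    (List.range 41).map (fun n : ℕ ↦ gThetaCoeff 4 n) =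
      [0, 1, 0, 0, 0, 2, 0, 0, 0, -1, 0, 0, 0, -2, 0, 0, 0, 0, 0, 0, 0, -4, 0, 0, 0, -1,
        0, 0, 0, 2, 0, 0, 0, -4, 0, 0, 0, 2, 0, 0, 0] := by
  decide +kernel

/-- `2 g θ₃₂ - g θ₈` through `q⁴⁹` on the computable side: `1, -3, 5, -7` at `n = 1, 9, 25, 49`,
`0` elsewhere. [cite: Tunnell1983Congruent, proof of Thm 2, p. 327] -/
theorem two_mul_gThetaCoeff_thirtyTwo_sub_expansion :
    (List.range 50).map (fun n : ℕ ↦ 2 * gThetaCoeff 32 n - gThetaCoeff 8 n) =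
      [0, 1, 0, 0, 0, 0, 0, 0, 0, -3, 0, 0, 0, 0, 0, 0, 0, 0, 0, 0, 0, 0, 0, 0, 0, 5,
        0, 0, 0, 0, 0, 0, 0, 0, 0, 0, 0, 0, 0, 0, 0, 0, 0, 0, 0, 0, 0, 0, 0, -7] := by
  decide +kernel

/-- Transfer of a table of values along the bridge `formCoeff t = gThetaCoeff t`. [folklore] -/
theorem map_formCoeff_eq {t : ℕ} (ht : 0 < t) (l : List ℕ) :
    l.map (fun n : ℕ ↦ formCoeff t n) = l.map (fun n : ℕ ↦ gThetaCoeff t n) :=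
  List.map_congr_left fun n _ ↦ formCoeff_eq_gThetaCoeff ht n

/-- Transfer to the forms: `qCoeffs (g θ_t) n = d_t(n)` along a list. [folklore] -/
theorem map_qCoeffs_tunnellForm_eq {t : ℕ} (ht : 0 < t) (l : List ℕ) :
    l.map (qCoeffs (tunnellForm t)) = (l.map fun n : ℕ ↦ gThetaCoeff t n).map ((↑) : ℤ → ℂ) := by
  rw [List.map_map, qCoeffs_tunnellForm_eq_gThetaCoeff ht]
  rfl

/-- **"`g θ₂ = q + 2q³ + q⁹ - 2q¹¹ - 4q¹⁷ - 2q¹⁹ - 3q²⁵ + 4q³³ - 4q³⁵ + ⋯`"**, the `q`-expansion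
of the weight-`3/2` form `g θ₂` as printed in the proof of Theorem 2 (Tunnell 1983, p. 327):
the first `36` Fourier coefficients of `tunnellForm 2`. [cite: Tunnell1983Congruent, proof of Thm 2, p. 327] -/
theorem qCoeffs_tunnellForm_two_expansion :
    (List.range 36).map (qCoeffs (tunnellForm 2)) =
      ([0, 1, 0, 2, 0, 0, 0, 0, 0, 1, 0, -2, 0, 0, 0, 0, 0, -4, 0, -2, 0, 0, 0, 0, 0, -3,
        0, 0, 0, 0, 0, 0, 0, 4, 0, -4] : List ℤ).map ((↑) : ℤ → ℂ) := by
  rw [map_qCoeffs_tunnellForm_eq two_pos, gThetaCoeff_two_expansion]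

/-- **"`g θ₈ = q + q⁹ - 4q¹⁷ - 3q²⁵ + 4q³³ + ⋯`"** (Tunnell 1983, p. 327): the first `34` Fourier
coefficients of `tunnellForm 8`. [cite: Tunnell1983Congruent, proof of Thm 2, p. 327] -/
theorem qCoeffs_tunnellForm_eight_expansion :
    (List.range 34).map (qCoeffs (tunnellForm 8)) =
      ([0, 1, 0, 0, 0, 0, 0, 0, 0, 1, 0, 0, 0, 0, 0, 0, 0, -4, 0, 0, 0, 0, 0, 0, 0, -3,
        0, 0, 0, 0, 0, 0, 0, 4] : List ℤ).map ((↑) : ℤ → ℂ) := by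
  rw [map_qCoeffs_tunnellForm_eq (by norm_num), gThetaCoeff_eight_expansion]

/-- **"`g θ₃₂ = q - q⁹ - 2q¹⁷ + q²⁵ + 2q³³ + ⋯`"** (Tunnell 1983, p. 327): the first `34` Fourier
coefficients of `tunnellForm 32`. [cite: Tunnell1983Congruent, proof of Thm 2, p. 327] -/
theorem qCoeffs_tunnellForm_thirtyTwo_expansion :
    (List.range 34).map (qCoeffs (tunnellForm 32)) =
      ([0, 1, 0, 0, 0, 0, 0, 0, 0, -1, 0, 0, 0, 0, 0, 0, 0, -2, 0, 0, 0, 0, 0, 0, 0, 1,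
        0, 0, 0, 0, 0, 0, 0, 2] : List ℤ).map ((↑) : ℤ → ℂ) := by
  rw [map_qCoeffs_tunnellForm_eq (by norm_num), gThetaCoeff_thirtyTwo_expansion]

/-- The `q`-expansion of `g θ₄ = ∑ b(n) qⁿ` through `q⁴⁰`:
`q + 2q⁵ - q⁹ - 2q¹³ - 4q²¹ - q²⁵ + 2q²⁹ - 4q³³ + 2q³⁷ + ⋯`. [cite: Tunnell1983Congruent, p. 328] -/
theorem qCoeffs_tunnellForm_four_expansion :
    (List.range 41).map (qCoeffs (tunnellForm 4)) =
      ([0, 1, 0, 0, 0, 2, 0, 0, 0, -1, 0, 0, 0, -2, 0, 0, 0, 0, 0, 0, 0, -4, 0, 0, 0, -1,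
        0, 0, 0, 2, 0, 0, 0, -4, 0, 0, 0, 2, 0, 0, 0] : List ℤ).map ((↑) : ℤ → ℂ) := by
  rw [map_qCoeffs_tunnellForm_eq (by norm_num), gThetaCoeff_four_expansion]

/-- **"it is clear that `2 g θ₃₂ - g θ₈ = ∑ χ(m) m q^{m²}`, where `χ` is the nontrivial quadratic
character of conductor `4`"** (Tunnell 1983, proof of Theorem 2, p. 327 — the third `T(3²)`,
`T(5²)`-eigenvector of `S_{3/2}(128, 1)`), checked on the Fourier coefficients through `q⁴⁹`:
`1, -3, 5, -7` at `n = 1, 9, 25, 49`, `0` elsewhere. [cite: Tunnell1983Congruent, proof of Thm 2, p. 327] -/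
theorem qCoeffs_two_mul_thirtyTwo_sub_eight_expansion :
    (List.range 50).map (fun n ↦ 2 * qCoeffs (tunnellForm 32) n - qCoeffs (tunnellForm 8) n) =
      ([0, 1, 0, 0, 0, 0, 0, 0, 0, -3, 0, 0, 0, 0, 0, 0, 0, 0, 0, 0, 0, 0, 0, 0, 0, 5,
        0, 0, 0, 0, 0, 0, 0, 0, 0, 0, 0, 0, 0, 0, 0, 0, 0, 0, 0, 0, 0, 0, 0, -7] : List ℤ).map
        ((↑) : ℤ → ℂ) := by
  rw [← two_mul_gThetaCoeff_thirtyTwo_sub_expansion, List.map_map,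
    qCoeffs_tunnellForm_eq_gThetaCoeff (by norm_num), qCoeffs_tunnellForm_eq_gThetaCoeff (by norm_num)]
  refine List.map_congr_left fun n _ ↦ ?_
  simp

/-- `c(1) = 1`: `g` is normalised (Theorem 1, "normalized newform"). [cite: Tunnell1983Congruent, Thm 1] -/
theorem gCoeff_one : gCoeff 1 = 1 := by
  decide +kernel

/-- On the theta side, `a(1) = ∑_j c(1 - 2j²) = c(1) = 1` ("Since `a(1) = 1` and `a(3) = 2` …",
Tunnell 1983, p. 329). [cite: Tunnell1983Congruent, p. 329] -/
theorem gThetaCoeff_two_one : gThetaCoeff 2 1 = 1 := by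
  decide +kernel

/-- On the theta side, `a(3) = c(3) + 2c(1) = 2` (Tunnell 1983, p. 329). [cite: Tunnell1983Congruent, p. 329] -/
theorem gThetaCoeff_two_three : gThetaCoeff 2 3 = 2 := by
  decide +kernel

/-- The first Fourier coefficient of `g θ₂` is `1` (`a(1) = 1`, p. 329). [cite: Tunnell1983Congruent, p. 329] -/
theorem qCoeffs_tunnellForm_two_one : qCoeffs (tunnellForm 2) 1 = 1 := by
  rw [qCoeffs_tunnellForm_eq_gThetaCoeff two_pos]
  simp [gThetaCoeff_two_one]

/-- The third Fourier coefficient of `g θ₂` is `2` (`a(3) = 2`, p. 329). [cite: Tunnell1983Congruent, p. 329] -/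
theorem qCoeffs_tunnellForm_two_three : qCoeffs (tunnellForm 2) 3 = 2 := by
  rw [qCoeffs_tunnellForm_eq_gThetaCoeff two_pos]
  simp [gThetaCoeff_two_three]

/-! ### Theorem 1: the two expressions agree (named fact, with `decide` evidence) -/

/-- The two expressions of Theorem 1 agree through `q⁸⁰`: `c'(n) = c(n)` for `n ≤ 80`, by
computation. [cite: Tunnell1983Congruent, Thm 1] -/
theorem gCoeff'_eq_gCoeff_of_lt : ∀ n ∈ Finset.range 81, gCoeff' n = gCoeff n := by
  decide +kernel

end Literature.NumberTheory.EllipticCurves.Tunnell1983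

namespace Literature.NumberTheory.EllipticCurves

/-- **Tunnell 1983, Theorem 1 (equality of the two `q`-expansions of `g`)**: "There exists a
unique normalized newform `g` of weight `1`, level `128` and character `χ₋₂`. The `q`-expansion of
this form is `g = ∑ (-1)^{m+n} q^{(4m+1)² + 16n²} = ∑ (-1)ⁿ q^{(4m+1)² + 8n²}`, where `(m, n)` is
in `ℤ × ℤ`." Vendored here is the coefficientwise content of the second equality,
`c'(n) = c(n)` for all `n` (`Literature.NumberTheory.EllipticCurves.Tunnell1983.gCoeff'`, `Literature.NumberTheory.EllipticCurves.Tunnell1983.gCoeff`), i.e. the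
theta series of the class-group character `η` of `ℚ(i)` (conductor `(1+i)⁵`) and of `η'` of
`ℚ(√-2)` coincide. Tunnell derives it by identifying both with the newform attached to the unique
dihedral Artin representation of conductor `128` and determinant `χ₋₂` (Labesse–Langlands, or
Deligne–Serre; pp. 326–327); alternatively both equal Jacobi's `q ∏ (1 - q^{8n})(1 - q^{16n})`
by the triple product identity (Remark, p. 327). Checked through `n = 80` in
`Literature.NumberTheory.EllipticCurves.Tunnell1983.gCoeff'_eq_gCoeff_of_lt`; the modular side (`tunnellG`) uses only `gCoeff`.
[cite: Tunnell1983Congruent, Thm 1] -/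
def Tunnell1983_gCoeff'_eq_gCoeff : Prop :=
  ∀ n : ℤ, Tunnell1983.gCoeff' n = Tunnell1983.gCoeff n

end Literature.NumberTheory.EllipticCurves

/-! ### The step "exponents modulo `8`" of the proof of Theorem 2, on Shimura's `T(p²)` -/

namespace Literature.NumberTheory.EllipticCurves.ModularForms

/-- `p² ≡ 1 (mod 8)` for odd `p`. [folklore] -/
theorem sq_mod_eight_of_odd {p : ℕ} (hp : Odd p) : p ^ 2 % 8 = 1 := by
  have h : p % 8 = 1 ∨ p % 8 = 3 ∨ p % 8 = 5 ∨ p % 8 = 7 := by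
    rw [Nat.odd_iff] at hp
    omega
  rw [Nat.pow_mod]
  rcases h with h | h | h | h <;> simp [h]

/-- **Tunnell 1983, proof of Theorem 2, pp. 327–328** ("It is clear from the formula for the action
of `T(p²)` [18, Theorem 1.7] that `T(p²)(g(θ₂ - θ₈))` and `T(p²)(g θ₈)` have the same properties
with respect to exponents modulo `8` appearing in the `q`-expansion"): for `p` odd, Shimura's
operator `T(p²)` on `q`-expansions (`heckeTSq`, any weight `k/2`, level and character) maps a
sequence supported on the class `n ≡ r (mod 8)` to a sequence supported on the same class, because
its three terms read `a` at `p² n`, `n` and `n/p²`, all `≡ n (mod 8)` as `p² ≡ 1 (mod 8)`.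
[cite: Tunnell1983Congruent, proof of Thm 2, pp. 327–328] -/
theorem heckeTSq_apply_eq_zero_of_mod_eight (k : ℕ) {N : ℕ} (χ : DirichletCharacter ℂ N) {p : ℕ}
    (hp : Odd p) {r : ℕ} {a : ℕ → ℂ} (ha : ∀ n, n % 8 ≠ r → a n = 0) {n : ℕ} (hn : n % 8 ≠ r) :
    heckeTSq k χ p a n = 0 := by
  have hp2 := sq_mod_eight_of_odd hp
  have h1 : a (p ^ 2 * n) = 0 := by
    refine ha _ ?_
    rw [Nat.mul_mod, hp2, one_mul, Nat.mod_mod]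
    exact hn
  have h3 : (if p ^ 2 ∣ n then a (n / p ^ 2) else 0) = 0 := by
    split_ifs with hdvd
    · obtain ⟨m, rfl⟩ := hdvd
      have hp0 : 0 < p ^ 2 := pow_pos hp.pos 2
      rw [Nat.mul_div_cancel_left m hp0]
      refine ha _ ?_
      rw [Nat.mul_mod, hp2, one_mul, Nat.mod_mod] at hn
      exact hn
    · rfl
  rw [heckeTSq_apply, h1, ha n hn, h3]
  ring

/-- The same for a support condition on two classes (`g θ₂`: `n ≡ 1` or `3 (mod 8)`; `g θ₄`:
`n ≡ 1` or `5`): `T(p²)`, `p` odd, preserves "`a(n) = 0` unless `n % 8 ∈ {r, r'}`".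
[cite: Tunnell1983Congruent, proof of Thm 2, pp. 327–328] -/
theorem heckeTSq_apply_eq_zero_of_mod_eight₂ (k : ℕ) {N : ℕ} (χ : DirichletCharacter ℂ N) {p : ℕ}
    (hp : Odd p) {r r' : ℕ} {a : ℕ → ℂ} (ha : ∀ n, n % 8 ≠ r → n % 8 ≠ r' → a n = 0) {n : ℕ}
    (hn : n % 8 ≠ r) (hn' : n % 8 ≠ r') : heckeTSq k χ p a n = 0 := by
  have hp2 := sq_mod_eight_of_odd hp
  have hmod : (p ^ 2 * n) % 8 = n % 8 := by rw [Nat.mul_mod, hp2, one_mul, Nat.mod_mod]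
  have h1 : a (p ^ 2 * n) = 0 := ha _ (by rw [hmod]; exact hn) (by rw [hmod]; exact hn')
  have h3 : (if p ^ 2 ∣ n then a (n / p ^ 2) else 0) = 0 := by
    split_ifs with hdvd
    · obtain ⟨m, rfl⟩ := hdvd
      have hp0 : 0 < p ^ 2 := pow_pos hp.pos 2
      rw [Nat.mul_div_cancel_left m hp0]
      have hmod' : (p ^ 2 * m) % 8 = m % 8 := by rw [Nat.mul_mod, hp2, one_mul, Nat.mod_mod]
      exact ha _ (by rw [← hmod']; exact hn) (by rw [← hmod']; exact hn')
    · rfl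
  rw [heckeTSq_apply, h1, ha n hn hn', h3]
  ring

/-- **`T(p²)(g θ₈)` has exponents `≡ 1 (mod 8)` only** (`p` odd; Tunnell 1983, pp. 327–328), for the
actual `q`-expansion of `tunnellForm 8`. [cite: Tunnell1983Congruent, proof of Thm 2, pp. 327–328] -/
theorem heckeTSq_qCoeffs_tunnellForm_eight_eq_zero (χ : DirichletCharacter ℂ 128) {p : ℕ}
    (hp : Odd p) {n : ℕ} (hn : n % 8 ≠ 1) :
    heckeTSq 3 χ p (qCoeffs (Tunnell1983.tunnellForm 8)) n = 0 := by
  refine heckeTSq_apply_eq_zero_of_mod_eight 3 χ hp (fun m hm ↦ ?_) hn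
  rw [Tunnell1983.qCoeffs_tunnellForm (by norm_num)]
  dsimp only
  rw [Tunnell1983.formCoeff_eight_eq_zero hm, Int.cast_zero]

/-- **`T(p²)(g(θ₂ - θ₈))` has exponents `≡ 3 (mod 8)` only** (`p` odd; Tunnell 1983, pp. 327–328:
"The form `g(θ₂ - θ₈)` has `qⁿ` appearing with nonzero coefficient only when `n ≡ 3 (8)` … It is
clear from the formula for the action of `T(p²)` that `T(p²)(g(θ₂ - θ₈))` … [has] the same
properties"), for the actual `q`-expansions. [cite: Tunnell1983Congruent, proof of Thm 2, pp. 327–328] -/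
theorem heckeTSq_qCoeffs_tunnellForm_two_sub_eight_eq_zero (χ : DirichletCharacter ℂ 128) {p : ℕ}
    (hp : Odd p) {n : ℕ} (hn : n % 8 ≠ 3) :
    heckeTSq 3 χ p (qCoeffs (Tunnell1983.tunnellForm 2) - qCoeffs (Tunnell1983.tunnellForm 8)) n
      = 0 := by
  refine heckeTSq_apply_eq_zero_of_mod_eight 3 χ hp (fun m hm ↦ ?_) hn
  rw [Pi.sub_apply, Tunnell1983.qCoeffs_tunnellForm (by norm_num),
    Tunnell1983.qCoeffs_tunnellForm (by norm_num)]
  dsimp only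
  by_cases h1 : m % 8 = 1
  · rw [Tunnell1983.formCoeff_eight_eq h1, sub_self]
  · rw [Tunnell1983.formCoeff_two_eq_zero ⟨h1, hm⟩, Tunnell1983.formCoeff_eight_eq_zero h1,
      Int.cast_zero, sub_self]

end Literature.NumberTheory.EllipticCurves.ModularForms
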